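import Summits.BirchSwinnertonDyer.BirchSwinnertonDyer.Theorems.ByReductionTypeAtTwoOrdKatoHalfAtTwoIsoHintOfAbbesUllmo
import Summits.BirchSwinnertonDyer.Rank1Residual.X5.KatoOrdTwoMuPart
import Literature.NumberTheory.EllipticCurves.IsogenyIdProofs
import HarnessLib

/-!
# Cert50a — crux-triage r1 seat 2 (GEN 50), crux `OrdKatoHalfAtTwoIso` (stmt-BirchSwinnertonDyer-19573), line `steinberg-fibre-at-two`:
# ROUTE-FILE-FREE kernel certificate of the DIRECT ROAD «G11⁺ ⟹ the `0 < Δ` conjunct» (written while the K4 route-file cone was farm-stale)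

HONEST FRAMING (cell bsd-2adic): BSD is not proved by any of this; G11⁺ (Greenberg LNM 1716 Conj. 1.11 at `p = 2` on the cell) is an OPEN
published conjecture, asserted nowhere — it is a HYPOTHESIS below. THEOREMS + two local `def`s (texts for quoting); no `sorry`, no instance,
no Literature fact. This file imports NEITHER the route file `Theses.ByReductionTypeAtTwo` NOR any module of its cone (only K4's X5 library,
the line's socket-4 door file and Literature), so it elaborates while that cone is stale; `Cert50.lean` (same folder) restates the results BY
NAME of `OrdKatoHalfAtTwoIsoPosDisc` / `FineSelmerConjATwoOrdPosDisc` once the cone serves — `PosDiscBody` below is the body of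
`SteinbergFibreAtTwo.OrdKatoHalfAtTwoIsoPosDisc` VERBATIM (`…PosDiscDefs.lean` :149–153), so `Cert50a.posDiscBody_of_g11pos` IS
`Cert50.posDisc_of_g11pos` up to `Iff.rfl`.

Content: `G11pos` (the LEAD g10 16:08Z / w3 GEN 6 binder list, verbatim) · `PosDiscBody` · `mainConjectureLowerDivisibilityAtTwoOrd_of_g11pos`
(G11⁺ + Abbes–Ullmo + Kato 17.4 (1)(2)@2 ⟹ Kato's integral lower divisibility AT `W` ITSELF for every curve of the cell — through K4's
`O1.katoMuPartAtTwo_of_mu_eq_zero`, whose hypothesis shape is G11⁺'s per-curve conclusion verbatim, `O1.mainConjectureLowerDivisibilityAtTwoOrd_of_katoMuPartAtTwo`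
and the line's `hint_two_of_abbesUllmo_of_irr`, ALL LANDED) · `posDiscBody_of_g11pos` (`W′ := W`). Reading for the announced v24 step (ii)
«{V♭⁺, Q⁺} ↦ G11⁺»: the `0 < Δ` conjunct closes from G11⁺ TODAY, with no Poitou–Tate consumer, no V♭⁺, no P⁺/Q⁺ in the composition.

References: R. Greenberg, LNM 1716 (1999) Conj. 1.11 p. 64 [GreenbergLNM1716]; K. Kato, Astérisque 295 (2004) Thm. 17.4 [Kato2004Asterisque];
A. Abbes, E. Ullmo, Compositio 103 (1996) Thm. A [AbbesUllmo1996]; tree: K4 `Rank1Residual/X5/KatoOrdTwoMuPart.lean`, line `…HintOfAbbesUllmo.lean`.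
-/

set_option autoImplicit false
set_option linter.dupNamespace false

noncomputable section

open scoped Classical MatrixGroups ModularForm

open CongruenceSubgroup WeierstrassCurve Literature.NumberTheory.EllipticCurves
  Literature.NumberTheory.EllipticCurves.ModularForms
  Literature.NumberTheory.EllipticCurves.Rank1Residual
  Literature.NumberTheory.EllipticCurves.SkinnerUrban2014
  Summit.BirchSwinnertonDyer.Rank1Residual.X5
open Summit.BirchSwinnertonDyer.BirchSwinnertonDyer.Theorems.SteinbergFibreAtTwo

namespace Summit.BirchSwinnertonDyer.BirchSwinnertonDyer.Cruxes.OrdKatoHalfAtTwoIso.Cert50a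

/-- [RESEARCH, OPEN — quoted, not asserted] **G11⁺ — Greenberg's Conjecture 1.11 at `p = 2` on the cell [`ρ̄₂` onto ∧ `0 < Δ`]**, the
LEAD's 16:08Z binder list = w3 GEN 6's `GreenbergMuZeroTwoOrdPosDisc` body, verbatim (= `Cert50.G11pos`).
[cite: GreenbergLNM1716, Conj. 1.11 (p. 64) (shape only; nothing asserted)] -/
def G11pos : Prop :=
  ∀ (W : WeierstrassCurve ℚ) [W.IsElliptic] [W.IsGloballyMinimal], ¬ W.HasCM → W.analyticRank = 0 →
    GoodOrd W 2 → W.HasSurjectiveModNGaloisRep 2 → 0 < W.Δ →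
    ∀ (κ : ZpExtension ℚ 2) (γ : Field.absoluteGaloisGroup ℚ), κ.IsCyclotomic → κ.IsTopGenerator γ → IsCyclotomicVariable 2 γ →
      ∀ D : W.SelmerDualData κ γ, D.mu = 0

/-- [RESEARCH, OPEN — quoted, not asserted] **The `0 < Δ` conjunct of the PAIR child 24097** — the body of
`SteinbergFibreAtTwo.OrdKatoHalfAtTwoIsoPosDisc` VERBATIM (`…PosDiscDefs.lean` :149–153), restated here only because that module's cone is
farm-stale. [cite: Kato2004Asterisque, Thm. 17.4 (p. 273) (shape only; nothing asserted)] -/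
def PosDiscBody : Prop :=
  ∀ (W : WeierstrassCurve ℚ) [W.IsElliptic] [W.IsGloballyMinimal], ¬ W.HasCM → W.analyticRank = 0 →
    Literature.NumberTheory.EllipticCurves.Rank1Residual.GoodOrd W 2 → W.HasSurjectiveModNGaloisRep 2 → 0 < W.Δ →
    ∃ (W' : WeierstrassCurve ℚ) (_ : W'.IsElliptic) (_ : W'.IsGloballyMinimal),
      WeierstrassCurve.IsIsogenous W W' ∧ Summit.BirchSwinnertonDyer.Rank1Residual.X5.O1.MainConjectureLowerDivisibilityAtTwoOrd W'

/-- **G11⁺ + Abbes–Ullmo + Kato 17.4 (1)(2) at `2` ⟹ Kato's integral lower divisibility `O1.MainConjectureLowerDivisibilityAtTwoOrd W` AT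
EVERY CURVE `W` OF THE CELL** (not merely at an isogenous member): `μ(X(W/ℚ_∞)) = 0` kills the residual `2^{μ(X)} ∣ L₀`
(`O1.katoMuPartAtTwo_of_mu_eq_zero`), Abbes–Ullmo gives `ord₂ ϖ = 0` on the good `E[2]`-irreducible locus (`hint_two_of_abbesUllmo_of_irr`,
irreducible because `ρ̄₂` is onto), and K4's master cancellation turns Kato's `char X ∣ 2ⁿ ϖ L₂` into `L₀ ∈ char X`
(`O1.mainConjectureLowerDivisibilityAtTwoOrd_of_katoMuPartAtTwo`). CONDITIONAL on the OPEN conjecture G11⁺; nothing closed.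
[cite: Kato2004Asterisque, Thm. 17.4 (1)(2) (p. 273)] [cite: AbbesUllmo1996, Thm. A] [cite: GreenbergLNM1716, Conj. 1.11 (p. 64) (shape)] -/
theorem mainConjectureLowerDivisibilityAtTwoOrd_of_g11pos (h : G11pos) (hAU : abbesUllmo_not_dvd_maninConstant_of_not_dvd_level)
    (W : WeierstrassCurve ℚ) [W.IsElliptic] [W.IsGloballyMinimal] (hcm : ¬ W.HasCM) (hr : W.analyticRank = 0) (hgo : GoodOrd W 2)
    (h2 : W.HasSurjectiveModNGaloisRep 2) (hΔ : 0 < W.Δ)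
    (h17 : ∀ [NeZero (W.conductorNorm ℤ)] (f : CuspForm (Gamma0 (W.conductorNorm ℤ)) 2),
      kato_divisibility_allPrimes W 2 (f := f)) :
    O1.MainConjectureLowerDivisibilityAtTwoOrd W := by
  haveI : NeZero ((2 : ℕ) : ℚ) := ⟨by norm_num⟩
  exact O1.mainConjectureLowerDivisibilityAtTwoOrd_of_katoMuPartAtTwo W h17
    (fun f hf ϖ hϖ => hint_two_of_abbesUllmo_of_irr hAU W hgo
      (hasIrreducibleModPGaloisRep_of_hasSurjectiveModNGaloisRep W 2 h2) f hf ϖ hϖ)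
    (O1.katoMuPartAtTwo_of_mu_eq_zero W (h W hcm hr hgo h2 hΔ))

/-- **THE DIRECT ROAD — G11⁺ + Abbes–Ullmo + Kato 17.4 (1)(2) at `2` ⟹ the `0 < Δ` conjunct** (`W′ := W`, identity isogeny). So the
announced v24 step (ii) closes the conjunct from G11⁺ through doors ALL landed today — no Poitou–Tate consumer, no V♭⁺, no P⁺/Q⁺ in the
composition. CONDITIONAL on G11⁺ (OPEN); nothing closed. [cite: Kato2004Asterisque, Thm. 17.4 (1)(2) (p. 273)] [cite: AbbesUllmo1996, Thm. A] -/
theorem posDiscBody_of_g11pos (h : G11pos) (hAU : abbesUllmo_not_dvd_maninConstant_of_not_dvd_level)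
    (h17 : ∀ (V : WeierstrassCurve ℚ) [V.IsElliptic] [V.IsGloballyMinimal] [NeZero (V.conductorNorm ℤ)]
      (f : CuspForm (Gamma0 (V.conductorNorm ℤ)) 2), kato_divisibility_allPrimes V 2 (f := f)) :
    PosDiscBody :=
  fun W _ _ hcm hr hgo h2 hΔ =>
    ⟨W, ‹_›, ‹_›, isIsogenous_self W, mainConjectureLowerDivisibilityAtTwoOrd_of_g11pos h hAU W hcm hr hgo h2 hΔ (h17 W)⟩

end Summit.BirchSwinnertonDyer.BirchSwinnertonDyer.Cruxes.OrdKatoHalfAtTwoIso.Cert50a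

end
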